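import Summits.ValiantsHypothesis.ValiantsHypothesis.Theorems.LacunarySymmetroidMatrixDescartesFanLawFour

/-!
# `MatrixDescartes` (stmt-ValiantsHypothesis-18050), line `Lift` — the signed fan law in CRUX CURRENCY
# (signed fan words: positive zeros, all real zeros, the `MatrixDescartes` inequality on the sector, pivot-column form)

HONEST FRAMING.  Cell `pub-symmetroid`, seat `val-sym-mdr-p2` (gen 3); helper `--supports` the crux
`Theses.LacunarySymmetroid.MatrixDescartes`, NO closure claim.  Word-level corollaries of `…FanLawFour.lean`
(`fanLawFour_lower/upper`; the sector conditions are spelled out inline, no new definitions):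
`fanWordFour_posRoots_le` (`Z₊ ≤ 2m` for signed fan words `∑ₗ X^{dₗ} Sₗ` — pivot and
factoring letter arbitrary symmetric, companions semidefinite with the sign of their position, one definite),
`fanWordFour_realRoots_le` (`Z ≤ 4m + 1` when the non-pivot exponents have one parity), `fanWordFour_mdr` (the crux's
inequality `Z^q ≤ 2^{K⌊log₂K⌋}` on this sector at every fat format, via `Census.fatFormat_absorb`), and
`pivotPosRoots_signedFan_le` (pivot column currency).  A SECTOR theorem: nothing here bears on `stub_twoSided` in
general, the crux in its window, `DoorA26`/`DoorA34`, or `VP ≠ VNP`.  [folklore] given `…FanLawFour.lean`.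
-/

-- layout Summits/ValiantsHypothesis/ValiantsHypothesis forces the duplicated namespace component
set_option linter.dupNamespace false

namespace Summit.ValiantsHypothesis.ValiantsHypothesis.Theorems.LacunarySymmetroidMatrixDescartes

open Polynomial Matrix Finset
open scoped BigOperators
open FanLawFour

/-- **Signed fan words, positive zeros** (crux currency): `Z₊ ≤ 2m`, every `K`. [folklore] -/
theorem fanWordFour_posRoots_le (K m : ℕ) (d : Fin K → ℕ) (S : Fin K → Matrix (Fin m) (Fin m) ℝ) (lp lf : Fin K)
    (hne : lf ≠ lp) (hS : (S lp).IsSymm) (hSf : (S lf).IsSymm)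
    (hfan : ((d lf < d lp ∧ ∀ l, l ≠ lp → l ≠ lf → (d lp < d l ∧ d l - d lp < d lp - d lf ∧ (S l).PosSemidef)
        ∨ (d l = d lp + (d lp - d lf) ∧ (S l).PosSemidef)
        ∨ (d l < d lp ∧ d lp - d l < d lp - d lf ∧ (-S l).PosSemidef)
        ∨ (d l < d lp ∧ d lp - d lf < d lp - d l ∧ d lp - d l < 2 * (d lp - d lf) ∧ (S l).PosSemidef)
        ∨ (d l + 2 * (d lp - d lf) = d lp ∧ (S l).PosSemidef))
      ∨ (d lp < d lf ∧ ∀ l, l ≠ lp → l ≠ lf → (d l < d lp ∧ d lp - d l < d lf - d lp ∧ (S l).PosSemidef)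
        ∨ (d l + (d lf - d lp) = d lp ∧ (S l).PosSemidef)
        ∨ (d lp < d l ∧ d l - d lp < d lf - d lp ∧ (-S l).PosSemidef)
        ∨ (d lp < d l ∧ d lf - d lp < d l - d lp ∧ d l - d lp < 2 * (d lf - d lp) ∧ (S l).PosSemidef)
        ∨ (d l = d lp + 2 * (d lf - d lp) ∧ (S l).PosSemidef))))
    (hdef : (∃ l, l ≠ lp ∧ l ≠ lf ∧
      (((S l).PosDef ∧ ¬ ((d lf < d lp ∧ d l < d lp ∧ d lp - d l < d lp - d lf)
          ∨ (d lp < d lf ∧ d lp < d l ∧ d l - d lp < d lf - d lp)))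
        ∨ ((-S l).PosDef ∧ ((d lf < d lp ∧ d l < d lp ∧ d lp - d l < d lp - d lf)
          ∨ (d lp < d lf ∧ d lp < d l ∧ d l - d lp < d lf - d lp)))))) :
    ((Matrix.det (∑ l, ((Polynomial.X : Polynomial ℝ) ^ d l) • (S l).map Polynomial.C)).roots.toFinset.filter
        (fun t => 0 < t)).card ≤ 2 * m := by
  classical
  have hsplit : ∑ l, ((Polynomial.X : Polynomial ℝ) ^ d l) • (S l).map Polynomial.C
      = ((Polynomial.X : Polynomial ℝ) ^ d lp) • (S lp).map Polynomial.C
        + ∑ l : {l // l ≠ lp}, ((Polynomial.X : Polynomial ℝ) ^ d l.1) • (S l.1).map Polynomial.C := by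
    rw [← Finset.add_sum_erase _ _ (Finset.mem_univ lp),
      Finset.sum_subtype (Finset.univ.erase lp) (p := fun l => l ≠ lp) (fun l => by simp [Finset.mem_erase])]
  rw [hsplit]
  obtain ⟨l₁, hl₁p, hl₁f, hl₁⟩ := hdef
  rcases hfan with ⟨hlow, h⟩ | ⟨hup, h⟩
  · have := fanLawFour_lower (κ := {l // l ≠ lp}) (d lp) (fun l => d l.1) (S lp) (fun l => S l.1) ⟨lf, hne⟩ hS hSf
      hlow (fun l hl => h l.1 l.2 fun hll => hl (Subtype.ext hll))
      ⟨⟨l₁, hl₁p⟩, fun hll => hl₁f (congrArg Subtype.val hll), by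
        rcases hl₁ with ⟨hpd, hn⟩ | ⟨hnd, hw⟩
        · exact Or.inl ⟨hpd, fun hc => hn (Or.inl ⟨hlow, hc⟩)⟩
        · refine Or.inr ⟨hnd, ?_⟩
          rcases hw with ⟨_, hw⟩ | ⟨hw, _⟩
          · exact hw
          · exact absurd hw (by omega)⟩
    simpa using this
  · have := fanLawFour_upper (κ := {l // l ≠ lp}) (d lp) (fun l => d l.1) (S lp) (fun l => S l.1) ⟨lf, hne⟩ hS hSf
      hup (fun l hl => h l.1 l.2 fun hll => hl (Subtype.ext hll))
      ⟨⟨l₁, hl₁p⟩, fun hll => hl₁f (congrArg Subtype.val hll), by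
        rcases hl₁ with ⟨hpd, hn⟩ | ⟨hnd, hw⟩
        · exact Or.inl ⟨hpd, fun hc => hn (Or.inr ⟨hup, hc⟩)⟩
        · refine Or.inr ⟨hnd, ?_⟩
          rcases hw with ⟨hw, _⟩ | ⟨_, hw⟩
          · exact absurd hw (by omega)
          · exact hw⟩
    simpa using this

/-- **Signed fan words, all real zeros**: with non-pivot exponents of one parity, `F(−X)` is again a signed fan word
with the same classes (up to an overall sign, which does not move roots), so `Z ≤ 4m + 1`. [folklore] -/
theorem fanWordFour_realRoots_le (K m : ℕ) (d : Fin K → ℕ) (S : Fin K → Matrix (Fin m) (Fin m) ℝ) (lp lf : Fin K)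
    (hne : lf ≠ lp) (hS : (S lp).IsSymm) (hSf : (S lf).IsSymm)
    (hfan : ((d lf < d lp ∧ ∀ l, l ≠ lp → l ≠ lf → (d lp < d l ∧ d l - d lp < d lp - d lf ∧ (S l).PosSemidef)
        ∨ (d l = d lp + (d lp - d lf) ∧ (S l).PosSemidef)
        ∨ (d l < d lp ∧ d lp - d l < d lp - d lf ∧ (-S l).PosSemidef)
        ∨ (d l < d lp ∧ d lp - d lf < d lp - d l ∧ d lp - d l < 2 * (d lp - d lf) ∧ (S l).PosSemidef)
        ∨ (d l + 2 * (d lp - d lf) = d lp ∧ (S l).PosSemidef))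
      ∨ (d lp < d lf ∧ ∀ l, l ≠ lp → l ≠ lf → (d l < d lp ∧ d lp - d l < d lf - d lp ∧ (S l).PosSemidef)
        ∨ (d l + (d lf - d lp) = d lp ∧ (S l).PosSemidef)
        ∨ (d lp < d l ∧ d l - d lp < d lf - d lp ∧ (-S l).PosSemidef)
        ∨ (d lp < d l ∧ d lf - d lp < d l - d lp ∧ d l - d lp < 2 * (d lf - d lp) ∧ (S l).PosSemidef)
        ∨ (d l = d lp + 2 * (d lf - d lp) ∧ (S l).PosSemidef))))
    (hdef : (∃ l, l ≠ lp ∧ l ≠ lf ∧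
      (((S l).PosDef ∧ ¬ ((d lf < d lp ∧ d l < d lp ∧ d lp - d l < d lp - d lf)
          ∨ (d lp < d lf ∧ d lp < d l ∧ d l - d lp < d lf - d lp)))
        ∨ ((-S l).PosDef ∧ ((d lf < d lp ∧ d l < d lp ∧ d lp - d l < d lp - d lf)
          ∨ (d lp < d lf ∧ d lp < d l ∧ d l - d lp < d lf - d lp)))))) (hpar : (∀ l, l ≠ lp → Even (d l)) ∨ (∀ l, l ≠ lp → Odd (d l))) :
    (Matrix.det (∑ l, ((Polynomial.X : Polynomial ℝ) ^ d l) • (S l).map Polynomial.C)).roots.toFinset.card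
      ≤ 4 * m + 1 := by
  have h1 := fanWordFour_posRoots_le K m d S lp lf hne hS hSf hfan hdef
  have h3 := stub_negRoots K m d S
  -- a family that agrees with `S` off the pivot and is symmetric at the pivot obeys the same bound
  have key : ∀ T : Fin K → Matrix (Fin m) (Fin m) ℝ, (∀ l, l ≠ lp → T l = S l) → (T lp).IsSymm →
      ((Matrix.det (∑ l, ((Polynomial.X : Polynomial ℝ) ^ d l) • (T l).map Polynomial.C)).roots.toFinset.filter
        (fun t => 0 < t)).card ≤ 2 * m := by
    intro T hT hTs
    refine fanWordFour_posRoots_le K m d T lp lf hne hTs (by rw [hT lf hne]; exact hSf) ?_ ?_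
    · rcases hfan with ⟨h0, h⟩ | ⟨h0, h⟩
      · refine Or.inl ⟨h0, fun l hl hlf => ?_⟩
        rw [hT l hl]; exact h l hl hlf
      · refine Or.inr ⟨h0, fun l hl hlf => ?_⟩
        rw [hT l hl]; exact h l hl hlf
    · obtain ⟨l₁, hl₁p, hl₁f, hl₁⟩ := hdef
      refine ⟨l₁, hl₁p, hl₁f, ?_⟩
      rw [hT l₁ hl₁p]; exact hl₁
  have h2 : ((Matrix.det (∑ l, ((Polynomial.X : Polynomial ℝ) ^ d l) •
      (((-1 : ℝ) ^ d l) • S l).map Polynomial.C)).roots.toFinset.filter (fun t => 0 < t)).card ≤ 2 * m := by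
    rcases hpar with hev | hodd
    · refine key (fun l => ((-1 : ℝ) ^ d l) • S l) (fun l hl => ?_) (hS.smul _)
      simp only [(hev l hl).neg_one_pow, one_smul]
    · rw [← roots_det_pencil_neg d (fun l => ((-1 : ℝ) ^ d l) • S l)]
      refine key (fun l => -(((-1 : ℝ) ^ d l) • S l)) (fun l hl => ?_) (hS.smul _).neg
      simp only [(hodd l hl).neg_one_pow, neg_smul, one_smul, neg_neg]
  omega

/-- **`MatrixDescartes` holds on the signed fan sector, at every fat format.**  For all `c, q` there is `K₀` such that
for all `K ≥ K₀`, all `m ≤ 2^((⌊log₂K⌋+c)^c)`, all exponents and letters forming a signed fan word with a definite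
companion and non-pivot exponents of one parity: `Z^q ≤ 2^(K⌊log₂K⌋)`.  Nothing is claimed outside the sector.
[folklore] -/
theorem fanWordFour_mdr (c q : ℕ) : ∃ K₀ : ℕ, ∀ K m : ℕ, K₀ ≤ K → m ≤ 2 ^ ((Nat.log 2 K + c) ^ c) →
    ∀ (d : Fin K → ℕ) (S : Fin K → Matrix (Fin m) (Fin m) ℝ) (lp lf : Fin K), lf ≠ lp → (S lp).IsSymm →
      (S lf).IsSymm →
      ((d lf < d lp ∧ ∀ l, l ≠ lp → l ≠ lf → (d lp < d l ∧ d l - d lp < d lp - d lf ∧ (S l).PosSemidef)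
        ∨ (d l = d lp + (d lp - d lf) ∧ (S l).PosSemidef)
        ∨ (d l < d lp ∧ d lp - d l < d lp - d lf ∧ (-S l).PosSemidef)
        ∨ (d l < d lp ∧ d lp - d lf < d lp - d l ∧ d lp - d l < 2 * (d lp - d lf) ∧ (S l).PosSemidef)
        ∨ (d l + 2 * (d lp - d lf) = d lp ∧ (S l).PosSemidef))
      ∨ (d lp < d lf ∧ ∀ l, l ≠ lp → l ≠ lf → (d l < d lp ∧ d lp - d l < d lf - d lp ∧ (S l).PosSemidef)
        ∨ (d l + (d lf - d lp) = d lp ∧ (S l).PosSemidef)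
        ∨ (d lp < d l ∧ d l - d lp < d lf - d lp ∧ (-S l).PosSemidef)
        ∨ (d lp < d l ∧ d lf - d lp < d l - d lp ∧ d l - d lp < 2 * (d lf - d lp) ∧ (S l).PosSemidef)
        ∨ (d l = d lp + 2 * (d lf - d lp) ∧ (S l).PosSemidef))) →
      (∃ l, l ≠ lp ∧ l ≠ lf ∧
      (((S l).PosDef ∧ ¬ ((d lf < d lp ∧ d l < d lp ∧ d lp - d l < d lp - d lf)
          ∨ (d lp < d lf ∧ d lp < d l ∧ d l - d lp < d lf - d lp)))
        ∨ ((-S l).PosDef ∧ ((d lf < d lp ∧ d l < d lp ∧ d lp - d l < d lp - d lf)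
          ∨ (d lp < d lf ∧ d lp < d l ∧ d l - d lp < d lf - d lp))))) →
      ((∀ l, l ≠ lp → Even (d l)) ∨ (∀ l, l ≠ lp → Odd (d l))) →
      (Matrix.det (∑ l, ((Polynomial.X : Polynomial ℝ) ^ d l) • (S l).map Polynomial.C)).roots.toFinset.card ^ q
        ≤ 2 ^ (K * Nat.log 2 K) := by
  obtain ⟨K₀, hK₀⟩ := Census.fatFormat_absorb 2 c q
  refine ⟨K₀, fun K m hK hm d S lp lf hne hS hSf hfan hdef hpar => hK₀ K m _ hK hm ?_⟩
  have h := fanWordFour_realRoots_le K m d S lp lf hne hS hSf hfan hdef hpar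
  have : 4 * m + 1 ≤ 2 ^ 2 * (m + 1) * (K + 1) := by nlinarith
  exact h.trans this

/-- The signed fan laws in the census currency of the pivot column (`…CensusPivotDefs`): `pivotPosRoots e d J P ≤ 2m`
uniformly in `K` and in the pivot index, for PSD letters `P k` in the closed window around a factoring letter with a
positive definite companion (the pivot column's letters are all `⪰ 0`, so the negative window is empty there).
[folklore] -/
theorem pivotPosRoots_signedFan_le (m K e : ℕ) (d : Fin K → ℕ) (J : Matrix (Fin m) (Fin m) ℝ)
    (P : Fin K → Matrix (Fin m) (Fin m) ℝ) (k₀ : Fin K) (hJ : J.IsSymm) (hP : ∀ k, (P k).PosSemidef)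
    (hfan : (d k₀ < e ∧ ∀ k, k ≠ k₀ → (e < d k ∧ d k - e ≤ e - d k₀)
        ∨ (d k < e ∧ e - d k₀ < e - d k ∧ e - d k ≤ 2 * (e - d k₀)))
      ∨ (e < d k₀ ∧ ∀ k, k ≠ k₀ → (d k < e ∧ e - d k ≤ d k₀ - e)
        ∨ (e < d k ∧ d k₀ - e < d k - e ∧ d k - e ≤ 2 * (d k₀ - e))))
    (hdef : ∃ k, k ≠ k₀ ∧ (P k).PosDef) :
    Pivot.pivotPosRoots e d J P ≤ 2 * m := by
  unfold Pivot.pivotPosRoots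
  obtain ⟨k₁, hk₁, hpd⟩ := hdef
  have hsy : (P k₀).IsSymm := Matrix.isHermitian_iff_isSymm.1 (hP k₀).1
  rcases hfan with ⟨hlow, h⟩ | ⟨hup, h⟩
  · have := fanLawFour_lower e d J P k₀ hJ hsy hlow (fun k hk => by
        rcases h k hk with ⟨h1, h2⟩ | ⟨h1, h2, h3⟩
        · rcases Nat.lt_or_eq_of_le h2 with h' | h'
          · exact Or.inl ⟨h1, h', hP k⟩
          · exact Or.inr (Or.inl ⟨by omega, hP k⟩)
        · rcases Nat.lt_or_eq_of_le h3 with h' | h'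
          · exact Or.inr (Or.inr (Or.inr (Or.inl ⟨h1, h2, h', hP k⟩)))
          · exact Or.inr (Or.inr (Or.inr (Or.inr ⟨by omega, hP k⟩))))
      ⟨k₁, hk₁, Or.inl ⟨hpd, fun hc => by rcases h k₁ hk₁ with h' | h' <;> omega⟩⟩
    simpa using this
  · have := fanLawFour_upper e d J P k₀ hJ hsy hup (fun k hk => by
        rcases h k hk with ⟨h1, h2⟩ | ⟨h1, h2, h3⟩
        · rcases Nat.lt_or_eq_of_le h2 with h' | h'
          · exact Or.inl ⟨h1, h', hP k⟩
          · exact Or.inr (Or.inl ⟨by omega, hP k⟩)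
        · rcases Nat.lt_or_eq_of_le h3 with h' | h'
          · exact Or.inr (Or.inr (Or.inr (Or.inl ⟨h1, h2, h', hP k⟩)))
          · exact Or.inr (Or.inr (Or.inr (Or.inr ⟨by omega, hP k⟩))))
      ⟨k₁, hk₁, Or.inl ⟨hpd, fun hc => by rcases h k₁ hk₁ with h' | h' <;> omega⟩⟩
    simpa using this

end Summit.ValiantsHypothesis.ValiantsHypothesis.Theorems.LacunarySymmetroidMatrixDescartes
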